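import Literature.NumberTheory.Automorphic.QuaternionNormTheorem
import Literature.NumberTheory.QuadraticForms.LandherrHermitianPlanesIff
import HarnessLib

/-!
# Elements represented by a binary hermitian form over a CM field, via the quaternion norm theorem

Topic `NumberTheory/QuadraticForms`; theorems only (no definition, no named fact, no instance).

Let `K` be a CM field, `σ = IsCMField.complexConj K`, `K⁺ = maximalRealSubfield K`,
`N(z) = z · σ z`. For non-zero `σ`-fixed `a₀, a₁, a₂` (elements of `K⁺ˣ`) the diagonal hermitian
plane `⟨a₀, a₁⟩` **represents** `a₂` — `a₀ N(p) + a₁ N(q) = a₂` for some `p, q ∈ K` — iff at every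
complex embedding `τ` at which `a₀` and `a₁` have the same sign, `a₂` has that sign too
(`hermitianPlane_represents_iff_signs`; at the embeddings where `⟨a₀, a₁⟩` is indefinite there is
no condition). This is the rank-2 case of the local–global principle for representations by
hermitian forms over `K/K⁺` (Landherr 1936; Scharlau, *Quadratic and Hermitian Forms*, Ch. 10),
and the special case `a₀ = a₁ = 1` says that **every totally positive element of `K⁺` is a sum of
two relative norms from `K`** (`exists_norm_add_norm_eq_of_forall_embedding_pos`; for
`K = K⁺(√-1)`: a sum of four squares in `K⁺`, Siegel 1921).

## Proof — the hermitian-to-quaternionic dictionary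

Pick `θ ≠ 0` with `σ θ = -θ` (`Landherr.exists_skew`) and put `d = θ² ∈ K⁺`. In the quaternion
algebra `H = (d, -a₀a₁)` over `K⁺` the reduced norm is
`n(h₀ + h₁ i + h₂ j + h₃ ij) = (h₀² - d h₁²) + a₀a₁ (h₂² - d h₃²) = N(h₀ + h₁θ) + a₀a₁ N(h₂ + h₃θ)`,
and a real place `ρ` of `K⁺` is ramified in `H` iff `ρ(d) < 0` (always) and `ρ(a₀a₁) > 0`. The
sign hypothesis says exactly that `a₀a₂` is positive at those places, so by the **norm theorem**
(Hasse–Schilling–Maass–Eichler, Vignéras LNM 800 III Thm. 4.1 — tree theorem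
`Literature.NumberTheory.Automorphic.exists_quaternary_norm_form_eq_of_forall_real_embedding`,
proved) `a₀a₂ = N(P) + a₀a₁ N(Q)`, i.e. `a₀ N(P/a₀) + a₁ N(Q) = a₂`. The converse is the sign of
`r₀‖τ p‖² + r₁‖τ q‖² = r₂` (`rᵢ = τ aᵢ ∈ ℝ`). This gives a second proof of the representation step
`Landherr.exists_rep_of_signs` of `LandherrHermitianPlanes.lean` (there: Hasse–Minkowski 66:1).

Provenance: `pub-hodgecm` reproduction of the arithmetic inputs of Deligne's "Hodge cycles on
abelian varieties" §4–5 (the package's `NormTheorem.lean`, `exists_rep_of_normTheorem` and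
`sumTwoNorms_of_lemma33bLandherr`), ported to Mathlib / tree vocabulary.

## References

* W. Landherr, Abh. Math. Sem. Univ. Hamburg 11 (1936) 245–248 [Landherr1936HermitianForms].
* W. Scharlau, *Quadratic and Hermitian Forms*, Grundlehren 270 (1985), Ch. 10
  [Scharlau1985HermitianForms].
* M.-F. Vignéras, *Arithmétique des algèbres de quaternions*, LNM 800 (1980), Ch. III §4
  Thm. 4.1 [VignerasLNM800].
-/

noncomputable section

open NumberField
open scoped ComplexConjugate

namespace Literature.NumberTheory.QuadraticForms

variable (K : Type) [Field K] [NumberField K] [IsCMField K]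

/-- **Sufficiency (norm theorem).** For non-zero `σ`-fixed `a₀, a₁, a₂` in the CM field `K`: if at
every complex embedding `τ` where `a₀, a₁` have the same sign, `a₂` has the sign of `a₀`, then
`a₀ N(p) + a₁ N(q) = a₂` for some `p, q ∈ K`. Proof: the norm theorem for the quaternion algebra
`(θ², -a₀a₁)` over `K⁺` applied to `a₀a₂` (module docstring). [cite: VignerasLNM800, Ch. III §4 Thm. 4.1] -/
theorem hermitianPlane_represents_of_signs (a₀ a₁ a₂ : K)
    (h₀ : IsCMField.complexConj K a₀ = a₀) (h₁ : IsCMField.complexConj K a₁ = a₁)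
    (h₂ : IsCMField.complexConj K a₂ = a₂) (ha₀ : a₀ ≠ 0) (ha₁ : a₁ ≠ 0) (ha₂ : a₂ ≠ 0)
    (hsgn : ∀ τ : K →+* ℂ, (0 < (τ a₀).re ↔ 0 < (τ a₁).re) → (0 < (τ a₂).re ↔ 0 < (τ a₀).re)) :
    ∃ p q : K, a₀ * (p * IsCMField.complexConj K p) + a₁ * (q * IsCMField.complexConj K q) = a₂ := by
  obtain ⟨θ, hθ0, hθ⟩ := Landherr.exists_skew K
  have hθ2 : IsCMField.complexConj K (θ ^ 2) = θ ^ 2 := by rw [map_pow, hθ, neg_sq]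
  have hfix : ∀ y : maximalRealSubfield K, IsCMField.complexConj K y = y :=
    IsCMField.complexConj_apply_eq_self K
  -- descend the data to `K⁺`
  let A₀ : maximalRealSubfield K := ⟨a₀, (IsCMField.complexConj_eq_self_iff K _).mp h₀⟩
  let A₁ : maximalRealSubfield K := ⟨a₁, (IsCMField.complexConj_eq_self_iff K _).mp h₁⟩
  let A₂ : maximalRealSubfield K := ⟨a₂, (IsCMField.complexConj_eq_self_iff K _).mp h₂⟩
  let D : maximalRealSubfield K := ⟨θ ^ 2, (IsCMField.complexConj_eq_self_iff K _).mp hθ2⟩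
  have hA₀ : A₀ ≠ 0 := fun h => ha₀ (by simpa [A₀] using congrArg Subtype.val h)
  have hA₁ : A₁ ≠ 0 := fun h => ha₁ (by simpa [A₁] using congrArg Subtype.val h)
  have hA₂ : A₂ ≠ 0 := fun h => ha₂ (by simpa [A₂] using congrArg Subtype.val h)
  have hD0 : D ≠ 0 := fun h => pow_ne_zero 2 hθ0 (by simpa [D] using congrArg Subtype.val h)
  -- the quaternion algebra `(θ², -a₀a₁)` over `K⁺` and the element `a₀a₂`
  have hB0 : -(A₀ * A₁) ≠ 0 := neg_ne_zero.mpr (mul_ne_zero hA₀ hA₁)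
  have hX0 : A₀ * A₂ ≠ 0 := mul_ne_zero hA₀ hA₂
  have hposX : ∀ ρ : maximalRealSubfield K →+* ℝ, ρ D < 0 → ρ (-(A₀ * A₁)) < 0 →
      0 < ρ (A₀ * A₂) := by
    intro ρ _ hB
    rw [map_neg, map_mul, neg_lt_zero] at hB
    obtain ⟨τ, hτ⟩ := Landherr.exists_embedding_extending K ρ
    have hre₀ : (τ a₀).re = ρ A₀ := by
      rw [show a₀ = ((A₀ : maximalRealSubfield K) : K) from rfl, hτ]; simp
    have hre₁ : (τ a₁).re = ρ A₁ := by
      rw [show a₁ = ((A₁ : maximalRealSubfield K) : K) from rfl, hτ]; simp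
    have hre₂ : (τ a₂).re = ρ A₂ := by
      rw [show a₂ = ((A₂ : maximalRealSubfield K) : K) from rfl, hτ]; simp
    have hρ₀ : ρ A₀ ≠ 0 := (map_ne_zero ρ).mpr hA₀
    have hρ₂ : ρ A₂ ≠ 0 := (map_ne_zero ρ).mpr hA₂
    -- `a₀, a₁` have the same sign at `ρ`, so `a₂` has the sign of `a₀`
    have h01 : 0 < ρ A₀ ↔ 0 < ρ A₁ := by
      rcases pos_and_pos_or_neg_and_neg_of_mul_pos hB with ⟨h0, h1⟩ | ⟨h0, h1⟩
      · exact ⟨fun _ => h1, fun _ => h0⟩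
      · exact ⟨fun h => absurd h0 (not_lt.mpr h.le), fun h => absurd h1 (not_lt.mpr h.le)⟩
    have h20 : 0 < ρ A₂ ↔ 0 < ρ A₀ := by
      have h := hsgn τ (by rw [hre₀, hre₁]; exact h01)
      rwa [hre₂, hre₀] at h
    rw [map_mul]
    by_cases hp : 0 < ρ A₀
    · exact mul_pos hp (h20.mpr hp)
    · have hn0 : ρ A₀ < 0 := lt_of_le_of_ne (not_lt.mp hp) hρ₀
      have hn2 : ρ A₂ < 0 := lt_of_le_of_ne (not_lt.mp fun h2 => hp (h20.mp h2)) hρ₂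
      exact mul_pos_of_neg_of_neg hn0 hn2
  -- the norm theorem: `a₀a₂ = n(h)` for some `h` in `(θ², -a₀a₁)`
  obtain ⟨h, hh⟩ := Literature.NumberTheory.Automorphic.exists_quaternary_norm_form_eq_of_forall_real_embedding
    (maximalRealSubfield K) hD0 hB0 hX0 hposX
  have hXfix : ∀ i, IsCMField.complexConj K (h i) = h i := fun i => hfix (h i)
  have eD : ((D : maximalRealSubfield K) : K) = θ ^ 2 := rfl
  have e₀ : ((A₀ : maximalRealSubfield K) : K) = a₀ := rfl
  have e₁ : ((A₁ : maximalRealSubfield K) : K) = a₁ := rfl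
  have e₂ : ((A₂ : maximalRealSubfield K) : K) = a₂ := rfl
  have hhL : (h 0 : K) ^ 2 - θ ^ 2 * (h 1 : K) ^ 2 - -(a₀ * a₁) * (h 2 : K) ^ 2
      + θ ^ 2 * -(a₀ * a₁) * (h 3 : K) ^ 2 = a₀ * a₂ := by
    have h' := congrArg Subtype.val hh
    push_cast at h'
    rw [eD, e₀, e₁, e₂] at h'
    linear_combination h'
  -- `P = h₀ + h₁θ`, `Q = h₂ + h₃θ`: `N(P) + a₀a₁ N(Q) = a₀a₂`
  obtain ⟨P, hP⟩ : ∃ P : K, P = (h 0 : K) + (h 1 : K) * θ := ⟨_, rfl⟩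
  obtain ⟨Q, hQ⟩ : ∃ Q : K, Q = (h 2 : K) + (h 3 : K) * θ := ⟨_, rfl⟩
  have hσP : IsCMField.complexConj K P = (h 0 : K) - (h 1 : K) * θ := by
    rw [hP, map_add, map_mul, hXfix, hXfix, hθ]; ring
  have hσQ : IsCMField.complexConj K Q = (h 2 : K) - (h 3 : K) * θ := by
    rw [hQ, map_add, map_mul, hXfix, hXfix, hθ]; ring
  have key : P * IsCMField.complexConj K P + a₀ * a₁ * (Q * IsCMField.complexConj K Q) =
      a₀ * a₂ := by
    rw [hσP, hσQ, hP, hQ]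
    linear_combination hhL
  -- divide `P` by `a₀`
  obtain ⟨u, hu⟩ : ∃ u : K, u = a₀⁻¹ := ⟨_, rfl⟩
  have hu1 : u * a₀ = 1 := by rw [hu]; exact inv_mul_cancel₀ ha₀
  have hufix : IsCMField.complexConj K u = u := by rw [hu, map_inv₀, h₀]
  refine ⟨P * u, Q, ?_⟩
  rw [map_mul, hufix]
  linear_combination u * key +
    (u * (P * IsCMField.complexConj K P) - a₁ * (Q * IsCMField.complexConj K Q) + a₂) * hu1

/-- **Necessity (signs).** If `a₀ N(p) + a₁ N(q) = a₂` with `σ`-fixed `a₀, a₁` and `a₂ ≠ 0`, then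
at every complex embedding where `a₀, a₁` have the same sign, `a₂` has that sign
(`r₀‖τ p‖² + r₁‖τ q‖² = r₂` with `rᵢ = τ aᵢ` real). [folklore] -/
theorem hermitianPlane_signs_of_represents (a₀ a₁ a₂ : K)
    (h₀ : IsCMField.complexConj K a₀ = a₀) (h₁ : IsCMField.complexConj K a₁ = a₁)
    (ha₀ : a₀ ≠ 0) (ha₂ : a₂ ≠ 0) {p q : K}
    (hrep : a₀ * (p * IsCMField.complexConj K p) + a₁ * (q * IsCMField.complexConj K q) = a₂)
    (τ : K →+* ℂ) (h01 : 0 < (τ a₀).re ↔ 0 < (τ a₁).re) : 0 < (τ a₂).re ↔ 0 < (τ a₀).re := by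
  have h₂ : IsCMField.complexConj K a₂ = a₂ := by
    rw [← hrep]
    simp only [map_add, map_mul, h₀, h₁, IsCMField.complexConj_apply_apply]
    ring
  have f : (τ a₀).re * ‖τ p‖ ^ 2 + (τ a₁).re * ‖τ q‖ ^ 2 = (τ a₂).re := by
    have h := congrArg τ hrep
    rw [map_add, Landherr.embedding_mul_norm h₀, Landherr.embedding_mul_norm h₁,
      Landherr.embedding_eq_re h₂ τ] at h
    exact_mod_cast h
  have hr0 : (τ a₀).re ≠ 0 := by
    intro h0
    exact ha₀ ((map_eq_zero τ).mp (by rw [Landherr.embedding_eq_re h₀ τ, h0]; simp))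
  have hr2 : (τ a₂).re ≠ 0 := by
    intro h0
    exact ha₂ ((map_eq_zero τ).mp (by rw [Landherr.embedding_eq_re h₂ τ, h0]; simp))
  have np : 0 ≤ ‖τ p‖ ^ 2 := by positivity
  have nq : 0 ≤ ‖τ q‖ ^ 2 := by positivity
  rcases lt_or_gt_of_ne hr0 with hn | hp
  · have hn1 : (τ a₁).re ≤ 0 := not_lt.mp fun h => (lt_asymm hn) (h01.mpr h)
    have : (τ a₂).re ≤ 0 := by nlinarith
    exact ⟨fun h => absurd (lt_of_le_of_ne this hr2) (lt_asymm h),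
      fun h => absurd hn (lt_asymm h)⟩
  · have hp1 : 0 < (τ a₁).re := h01.mp hp
    have : 0 ≤ (τ a₂).re := by nlinarith
    exact ⟨fun _ => hp, fun _ => lt_of_le_of_ne this hr2.symm⟩

/-- **Representation of elements by binary hermitian forms over a CM field** (rank-2 case of the
local–global principle for hermitian representations; Landherr 1936, Scharlau Ch. 10): for non-zero
`σ`-fixed `a₀, a₁, a₂` in the CM field `K`, `a₀ N(p) + a₁ N(q) = a₂` is solvable in `K` iff at
every complex embedding where `a₀` and `a₁` have the same sign, `a₂` has that sign.
[cite: Landherr1936HermitianForms] -/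
theorem hermitianPlane_represents_iff_signs (a₀ a₁ a₂ : K)
    (h₀ : IsCMField.complexConj K a₀ = a₀) (h₁ : IsCMField.complexConj K a₁ = a₁)
    (h₂ : IsCMField.complexConj K a₂ = a₂) (ha₀ : a₀ ≠ 0) (ha₁ : a₁ ≠ 0) (ha₂ : a₂ ≠ 0) :
    (∃ p q : K, a₀ * (p * IsCMField.complexConj K p) + a₁ * (q * IsCMField.complexConj K q) = a₂) ↔
      ∀ τ : K →+* ℂ, (0 < (τ a₀).re ↔ 0 < (τ a₁).re) → (0 < (τ a₂).re ↔ 0 < (τ a₀).re) :=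
  ⟨fun ⟨_, _, hrep⟩ τ h01 => hermitianPlane_signs_of_represents K a₀ a₁ a₂ h₀ h₁ ha₀ ha₂ hrep τ h01,
   hermitianPlane_represents_of_signs K a₀ a₁ a₂ h₀ h₁ h₂ ha₀ ha₁ ha₂⟩

/-- **Every totally positive element of `K⁺` is a sum of two relative norms from the CM field `K`**:
if `σ x = x` and `τ x > 0` at every complex embedding `τ` of `K`, then `x = N(p) + N(q)` for some
`p, q ∈ K` (the norm theorem for the quaternion algebra `(θ², -1)` over `K⁺`, which is ramified at
every real place; for `K = K⁺(√-1)` this is Siegel's four-square theorem for the totally real field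
`K⁺`). The case `a₀ = a₁ = 1` of `hermitianPlane_represents_of_signs`.
[cite: VignerasLNM800, Ch. III §4 Thm. 4.1] -/
theorem exists_norm_add_norm_eq_of_forall_embedding_pos (x : K)
    (hx : IsCMField.complexConj K x = x) (hpos : ∀ τ : K →+* ℂ, 0 < (τ x).re) :
    ∃ p q : K, p * IsCMField.complexConj K p + q * IsCMField.complexConj K q = x := by
  have hx0 : x ≠ 0 := by
    obtain ⟨τ⟩ : Nonempty (K →+* ℂ) := inferInstance
    intro h
    have := hpos τ
    rw [h, map_zero, Complex.zero_re] at this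
    exact lt_irrefl 0 this
  obtain ⟨p, q, h⟩ := hermitianPlane_represents_of_signs K 1 1 x (map_one _) (map_one _) hx
    one_ne_zero one_ne_zero hx0 (fun τ _ => by simpa using hpos τ)
  exact ⟨p, q, by simpa using h⟩

end Literature.NumberTheory.QuadraticForms

end
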